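import Literature.NumberTheory.Adeles.FiniteAdeleLatticeOfGLLevel              -- ★ `latticeOfGL`, `mem_latticeOfGL_iff`, strong approximation
import Literature.NumberTheory.Automorphic.GLnAdelicStructure                 -- ★ `integralFiniteAdeles`
import Mathlib.RingTheory.DedekindDomain.AdicValuation
import HarnessLib

/-!
# The lattices of a twisted frame READ AT ONE PLACE: membership in `Λ_a`, `𝔭⁻¹Λ_a` and the Hecke-neighbour lattice `H(g)` through a local coordinate
# ([Milne 2005] §4 pp. 48–49, §6 p. 75; [Shimura 1971] §3.2; abstract form of the (L-c)(L-c′) readings of the P6 Hecke-roof census)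

Topic `NumberTheory/Adeles`; namespace `Literature.NumberTheory.Adeles.Readout`.  THEOREMS ONLY (no definition, no named fact, no instance, no notation,
no `sorry`).  Cell `hodgecm-mathlib`, half A line L5, X-LEAF socket `stub_EHECKE`, organ (O-L) part 2 = FILE B (DEAL L5-#6, LA5-p02 (g3)), layer (B3a):
the θ-MEMBERSHIP identifications BY VALUE over an ABSTRACT readout datum — a ring homomorphism `A : M₂(𝔸_{F,f}) →+* M_N(𝔸_{ℚ,f})` (the consumer՚s
`X ↦ γ_𝔸·res(X ⊗ 1)·γ_𝔸⁻¹`), a place `u₀`, an idempotent adèle `ε = 1_{u₀}`, and a local coordinate `θ : 𝔸_{ℚ,f}^N →+ F_{u₀}²` with the properties (H2a)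
(H2b) (H3) of FILE A (`UnitaryCurveAuxiliaryFrameLatticeLocalComponent`, LA5-p01 (g3)) taken as HYPOTHESES — so that FILE A plugs in by instantiation
and the counts∕injectivity follow from ★ `LatticeIndexLocalReadout` + ★ `AdicCompletionBallLatticeIndex`.  `--supports stmt-HodgeConjecture-24832`,
count-neutral; HC_CM is proved only modulo the 7 printed citations until rung 0 closes; this file is generic and discharges none.

## Setting (all hypotheses, nothing defined)
`A : Matrix (Fin 2) (Fin 2) 𝔸_F →+* Matrix N N 𝔸_ℚ`; `u₀`; `ε : 𝔸_F`; `θ : (N → 𝔸_ℚ) →+ (Fin 2 → F_{u₀})`; `m : ℤ`; the lattice of `a ∈ GL₂(𝔸_F)` is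
`Λ_a := latticeOfGL (Units.map A a) = {q ∈ ℚ^N | A(a⁻¹) q ∈ ẑ^N}`.  Hypotheses by name: `hsplit` (H2a: integrality = `ε`-part ∧ `(1−ε)`-part),
`hθint` (H3: `ε`-part integral ↔ `θ ∈ B(m,m)`), `hθA` (H3: `θ (A X z) = X_{u₀} θ z`), `haway` (H2b), `hint` (`A(X)` preserves `ẑ^N` for the integral
scalars `X = b • 1`, `b ∈ 𝓞_F`).

* §1 `mem_latticeOfGL_map_iff_readout` — (7a) `q ∈ Λ_a ↔ away(a, q) ∧ θ(A(a⁻¹) q) ∈ B(m,m)`.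
* §2 `mem_iInf_comap_latticeOfGL_map_iff_readout` — (7b) for the prime `𝔭 = 𝔭_{u₀}` and a reading `ρ : 𝓞_F →+* M_N(ℚ)` with `ρ(b)_𝔸 = A(b • 1)`:
  `q ∈ 𝔭⁻¹Λ_a := ⨅_{π ∈ 𝔭} ρ(π)⁻¹Λ_a ↔ away(a, q) ∧ θ(A(a⁻¹) q) ∈ B(m−1,m−1)`.
* §3 (ED. 2) **`exists_rat_readout_sub_mem`** — (8) DENSITY: every `e ∈ B(m−k,m−k)` is `θ(A(a⁻¹) q)` modulo `B(m,m)` for a rational `q` integral away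
  from `u₀` (strong approximation ★ `exists_mem_latticeOfGL_mulVec_sub_mem_levelIdeal` at the rescaled point `p^{-k}·A(a)`, level `p^{2k}`).
* §4 (ED. 3) **`forall_mulVec_mem_latticeOfGL_map_mul_iff_readout`** — (7c) the Hecke-neighbour lattice `H(g) = 𝔮⁻¹Λ_{a g} ⊓ 𝔭⁻¹Λ_a` is
  «away ∧ `g_{u₀}⁻¹ θ(A(a⁻¹) q) ∈ B(m,m)`» for a prime `𝔮` with a `u₀`-unit and `g` in a Hecke coset at `u₀`.

## References
* [Milne2005ShimuraVarieties] J. S. Milne, *Introduction to Shimura varieties* (2005), §4 pp. 48–49, §6 Thm. 6.11 p. 74 and p. 75.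
* [ShimuraIATAF1971] G. Shimura, *Introduction to the Arithmetic Theory of Automorphic Functions* (1971), §3.2.
* [Deligne1971TravauxShimura] P. Deligne, *Travaux de Shimura*, Sém. Bourbaki 389 (1971), 4.11–4.12, Exemple 4.16 p. 150.

#harness_tags number_theory.adeles, linear_algebra.lattices
-/

set_option autoImplicit false

noncomputable section

open Matrix NumberField IsDedekindDomain
open Literature.AlgebraicGeometry.ModuliOfAbelianVarieties (finAdeleQ)
open Literature.NumberTheory.Automorphic (integralFiniteAdeles)
open Literature.NumberTheory.Adeles (latticeOfGL mem_latticeOfGL_iff)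

namespace Literature.NumberTheory.Adeles.Readout

variable {F : Type} [Field F] [NumberField F] {N : Type} [Fintype N] [DecidableEq N]
  (A : Matrix (Fin 2) (Fin 2) (FiniteAdeleRing (𝓞 F) F) →+* Matrix N N finAdeleQ)
  (u₀ : HeightOneSpectrum (𝓞 F)) (ε : FiniteAdeleRing (𝓞 F) F)
  (θ : (N → finAdeleQ) →+ (Fin 2 → u₀.adicCompletion F)) (m : ℤ)

/-! ### §1 (7a) The lattice `Λ_a` read at `u₀` -/

/-- `(Units.map A a)⁻¹` reads `A(a⁻¹)`. [folklore] -/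
private theorem coe_unitsMap_inv (a : GL (Fin 2) (FiniteAdeleRing (𝓞 F) F)) :
    (((Units.map (A : Matrix (Fin 2) (Fin 2) (FiniteAdeleRing (𝓞 F) F) →* Matrix N N finAdeleQ) a)⁻¹ : GL N finAdeleQ) :
      Matrix N N finAdeleQ) = A ((a⁻¹ : GL (Fin 2) (FiniteAdeleRing (𝓞 F) F)) : Matrix (Fin 2) (Fin 2) (FiniteAdeleRing (𝓞 F) F)) :=
  Units.coe_map_inv _ _

/-- **(7a) `q ∈ Λ_a ↔ away ∧ θ(A(a⁻¹) q) ∈ B(m,m)`**: membership in the twisted-frame lattice of `a` is «`A(a⁻¹)q` integral» (★ `mem_latticeOfGL_iff`),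
which splits along `ε` (H2a) into the AWAY part and the `u₀`-part, the latter read by `θ` (H3). [cite: Milne2005ShimuraVarieties, §4 pp. 48–49]
[cite: Deligne1971TravauxShimura, Exemple 4.16 p. 150] -/
theorem mem_latticeOfGL_map_iff_readout
    (hsplit : ∀ z : N → finAdeleQ, (∀ i, z i ∈ integralFiniteAdeles ℚ) ↔
      (∀ i, (A (ε • (1 : Matrix (Fin 2) (Fin 2) (FiniteAdeleRing (𝓞 F) F))) *ᵥ z) i ∈ integralFiniteAdeles ℚ) ∧
      (∀ i, (A ((1 - ε) • (1 : Matrix (Fin 2) (Fin 2) (FiniteAdeleRing (𝓞 F) F))) *ᵥ z) i ∈ integralFiniteAdeles ℚ))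
    (hθint : ∀ z : N → finAdeleQ,
      (∀ i, (A (ε • (1 : Matrix (Fin 2) (Fin 2) (FiniteAdeleRing (𝓞 F) F))) *ᵥ z) i ∈ integralFiniteAdeles ℚ) ↔
        ∀ j, Valued.v (θ z j) ≤ WithZero.exp (-m))
    (a : GL (Fin 2) (FiniteAdeleRing (𝓞 F) F)) (q : N → ℚ) :
    q ∈ latticeOfGL (Units.map (A : Matrix (Fin 2) (Fin 2) (FiniteAdeleRing (𝓞 F) F) →* Matrix N N finAdeleQ) a) ↔
      (∀ i, (A ((1 - ε) • (1 : Matrix (Fin 2) (Fin 2) (FiniteAdeleRing (𝓞 F) F))) *ᵥ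
          (A ((a⁻¹ : GL (Fin 2) (FiniteAdeleRing (𝓞 F) F)) : Matrix (Fin 2) (Fin 2) (FiniteAdeleRing (𝓞 F) F)) *ᵥ
            (⇑(algebraMap ℚ finAdeleQ) ∘ q))) i ∈ integralFiniteAdeles ℚ) ∧
      ∀ j, Valued.v (θ (A ((a⁻¹ : GL (Fin 2) (FiniteAdeleRing (𝓞 F) F)) : Matrix (Fin 2) (Fin 2) (FiniteAdeleRing (𝓞 F) F)) *ᵥ
          (⇑(algebraMap ℚ finAdeleQ) ∘ q)) j) ≤ WithZero.exp (-m) := by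
  rw [mem_latticeOfGL_iff, coe_unitsMap_inv, hsplit, hθint, and_comm]

/-! ### §2 (7b) The lattice `𝔭⁻¹Λ_a = ⨅_{π ∈ 𝔭} ρ(π)⁻¹Λ_a` read at `u₀` (`𝔭 = 𝔭_{u₀}`) -/

/-- Scalar matrices are central: `(c • 1) * M = M * (c • 1)`. [folklore] -/
private theorem smul_one_mul_eq_mul_smul_one {R : Type*} [CommSemiring R] {n : Type*} [Fintype n] [DecidableEq n]
    (c : R) (M : Matrix n n R) : (c • (1 : Matrix n n R)) * M = M * (c • (1 : Matrix n n R)) := by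
  rw [Matrix.smul_mul, Matrix.one_mul, Matrix.mul_smul, Matrix.mul_one]

/-- The coordinate map of a scalar matrix: `(c • 1).map (· u₀) = c_{u₀} • 1`. [folklore] -/
private theorem map_eval_smul_one (c : FiniteAdeleRing (𝓞 F) F) :
    ((c • (1 : Matrix (Fin 2) (Fin 2) (FiniteAdeleRing (𝓞 F) F))).map fun x : FiniteAdeleRing (𝓞 F) F => x u₀) =
      (c u₀) • (1 : Matrix (Fin 2) (Fin 2) (u₀.adicCompletion F)) := by
  ext i j
  simp only [Matrix.map_apply, Matrix.smul_apply, Matrix.one_apply, smul_eq_mul, mul_ite, mul_one, mul_zero]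
  split_ifs
  · rfl
  · rfl

/-- The valuation at `u₀` of the diagonal image of `π ∈ 𝓞_F`: `≤ exp(−1)` iff `π ∈ 𝔭_{u₀}`, and a uniformizer achieves `exp(−1)`. [folklore] -/
private theorem valued_algebraMap_apply_le_iff (π : 𝓞 F) (n : ℕ) :
    Valued.v ((algebraMap F (FiniteAdeleRing (𝓞 F) F) (π : F)) u₀) ≤ WithZero.exp (-(n : ℤ)) ↔ π ∈ u₀.asIdeal ^ n := by
  rw [IsDedekindDomain.FiniteAdeleRing.algebraMap_apply, IsDedekindDomain.HeightOneSpectrum.valuedAdicCompletion_eq_valuation',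
    IsDedekindDomain.HeightOneSpectrum.valuation_of_algebraMap, IsDedekindDomain.HeightOneSpectrum.intValuation_le_pow_iff_mem]

/-- `exp(t) · x ≤ exp(s) ↔ x ≤ exp(s − t)` in `ℤᵐ⁰`. [folklore] -/
private theorem exp_mul_le_exp_iff (t s : ℤ) (x : WithZero (Multiplicative ℤ)) :
    WithZero.exp t * x ≤ WithZero.exp s ↔ x ≤ WithZero.exp (s - t) := by
  constructor
  · intro h
    have h2 := mul_le_mul' (le_refl (WithZero.exp (-t))) h
    rwa [← mul_assoc, ← WithZero.exp_add, neg_add_cancel, WithZero.exp_zero, one_mul, ← WithZero.exp_add,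
      show -t + s = s - t by omega] at h2
  · intro h
    have h2 := mul_le_mul' (le_refl (WithZero.exp t)) h
    rwa [← WithZero.exp_add, show t + (s - t) = s by omega] at h2

/-- **(7b) `q ∈ 𝔭⁻¹Λ_a ↔ away ∧ θ(A(a⁻¹) q) ∈ B(m−1, m−1)`** for `𝔭 = 𝔭_{u₀}` and a rational reading `ρ` of `𝓞_F` with `ρ(b) ⊗ 1 = A(b • 1)`: the conditions
«`ρ(π) q ∈ Λ_a` for all `π ∈ 𝔭`» read, after (7a), as «`π_{u₀} · θ y ∈ B(m,m)` for all `π ∈ 𝔭`» (⇔ `θ y ∈ B(m−1,m−1)`, a uniformizer lies in `𝔭 ⊆ 𝓞_F`)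
and «`A((1−ε)π) y` integral for all `π ∈ 𝔭`» (⇔ the away part, by H2b and the integrality of `A(π • 1)`), `y = A(a⁻¹) q`.
[cite: Milne2005ShimuraVarieties, §4 pp. 48–49, §6 p. 75] [cite: ShimuraIATAF1971, §3.2] -/
theorem forall_mulVec_mem_latticeOfGL_map_iff_readout
    (hsplit : ∀ z : N → finAdeleQ, (∀ i, z i ∈ integralFiniteAdeles ℚ) ↔
      (∀ i, (A (ε • (1 : Matrix (Fin 2) (Fin 2) (FiniteAdeleRing (𝓞 F) F))) *ᵥ z) i ∈ integralFiniteAdeles ℚ) ∧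
      (∀ i, (A ((1 - ε) • (1 : Matrix (Fin 2) (Fin 2) (FiniteAdeleRing (𝓞 F) F))) *ᵥ z) i ∈ integralFiniteAdeles ℚ))
    (hθint : ∀ z : N → finAdeleQ,
      (∀ i, (A (ε • (1 : Matrix (Fin 2) (Fin 2) (FiniteAdeleRing (𝓞 F) F))) *ᵥ z) i ∈ integralFiniteAdeles ℚ) ↔
        ∀ j, Valued.v (θ z j) ≤ WithZero.exp (-m))
    (hθA : ∀ (X : Matrix (Fin 2) (Fin 2) (FiniteAdeleRing (𝓞 F) F)) (z : N → finAdeleQ),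
      θ (A X *ᵥ z) = (X.map fun x : FiniteAdeleRing (𝓞 F) F => x u₀) *ᵥ θ z)
    (haway : ∀ z : N → finAdeleQ,
      (∀ π ∈ u₀.asIdeal, ∀ i, (A (((1 - ε) * algebraMap F (FiniteAdeleRing (𝓞 F) F) ((π : 𝓞 F) : F)) •
        (1 : Matrix (Fin 2) (Fin 2) (FiniteAdeleRing (𝓞 F) F))) *ᵥ z) i ∈ integralFiniteAdeles ℚ) →
      ∀ i, (A ((1 - ε) • (1 : Matrix (Fin 2) (Fin 2) (FiniteAdeleRing (𝓞 F) F))) *ᵥ z) i ∈ integralFiniteAdeles ℚ)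
    (hint : ∀ (b : 𝓞 F) (z : N → finAdeleQ), (∀ i, z i ∈ integralFiniteAdeles ℚ) →
      ∀ i, (A ((algebraMap F (FiniteAdeleRing (𝓞 F) F) ((b : 𝓞 F) : F)) • (1 : Matrix (Fin 2) (Fin 2) (FiniteAdeleRing (𝓞 F) F))) *ᵥ z) i ∈
        integralFiniteAdeles ℚ)
    (ρ : 𝓞 F →+* Matrix N N ℚ)
    (hρ : ∀ b : 𝓞 F, (ρ b).map (algebraMap ℚ finAdeleQ) =
      A ((algebraMap F (FiniteAdeleRing (𝓞 F) F) ((b : 𝓞 F) : F)) • (1 : Matrix (Fin 2) (Fin 2) (FiniteAdeleRing (𝓞 F) F))))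
    (a : GL (Fin 2) (FiniteAdeleRing (𝓞 F) F)) (q : N → ℚ) :
    (∀ π ∈ u₀.asIdeal, ρ π *ᵥ q ∈
        latticeOfGL (Units.map (A : Matrix (Fin 2) (Fin 2) (FiniteAdeleRing (𝓞 F) F) →* Matrix N N finAdeleQ) a)) ↔
      (∀ i, (A ((1 - ε) • (1 : Matrix (Fin 2) (Fin 2) (FiniteAdeleRing (𝓞 F) F))) *ᵥ
          (A ((a⁻¹ : GL (Fin 2) (FiniteAdeleRing (𝓞 F) F)) : Matrix (Fin 2) (Fin 2) (FiniteAdeleRing (𝓞 F) F)) *ᵥ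
            (⇑(algebraMap ℚ finAdeleQ) ∘ q))) i ∈ integralFiniteAdeles ℚ) ∧
      ∀ j, Valued.v (θ (A ((a⁻¹ : GL (Fin 2) (FiniteAdeleRing (𝓞 F) F)) : Matrix (Fin 2) (Fin 2) (FiniteAdeleRing (𝓞 F) F)) *ᵥ
          (⇑(algebraMap ℚ finAdeleQ) ∘ q)) j) ≤ WithZero.exp (-(m - 1)) := by
  -- abbreviations
  set y : N → finAdeleQ := A ((a⁻¹ : GL (Fin 2) (FiniteAdeleRing (𝓞 F) F)) : Matrix (Fin 2) (Fin 2) (FiniteAdeleRing (𝓞 F) F)) *ᵥ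
    (⇑(algebraMap ℚ finAdeleQ) ∘ q) with hy
  -- the reading of `ρ π q` in adelic coordinates: `A(a⁻¹) (ρ π q)^ = A(π • 1) y`
  have hread : ∀ π : 𝓞 F,
      A ((a⁻¹ : GL (Fin 2) (FiniteAdeleRing (𝓞 F) F)) : Matrix (Fin 2) (Fin 2) (FiniteAdeleRing (𝓞 F) F)) *ᵥ
          (⇑(algebraMap ℚ finAdeleQ) ∘ (ρ π *ᵥ q)) =
        A ((algebraMap F (FiniteAdeleRing (𝓞 F) F) ((π : 𝓞 F) : F)) • (1 : Matrix (Fin 2) (Fin 2) (FiniteAdeleRing (𝓞 F) F))) *ᵥ y := by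
    intro π
    have h1 : (⇑(algebraMap ℚ finAdeleQ) ∘ (ρ π *ᵥ q)) = (ρ π).map (algebraMap ℚ finAdeleQ) *ᵥ (⇑(algebraMap ℚ finAdeleQ) ∘ q) := by
      funext i
      exact RingHom.map_mulVec (algebraMap ℚ finAdeleQ) (ρ π) q i
    rw [h1, hρ, Matrix.mulVec_mulVec, ← map_mul, ← smul_one_mul_eq_mul_smul_one, map_mul, ← Matrix.mulVec_mulVec]
  -- the `θ`-reading of `A(π • 1) y`: `π_{u₀} • θ y`
  have hθπ : ∀ π : 𝓞 F, θ (A ((algebraMap F (FiniteAdeleRing (𝓞 F) F) ((π : 𝓞 F) : F)) •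
      (1 : Matrix (Fin 2) (Fin 2) (FiniteAdeleRing (𝓞 F) F))) *ᵥ y) =
        ((algebraMap F (FiniteAdeleRing (𝓞 F) F) ((π : 𝓞 F) : F)) u₀) • θ y := by
    intro π
    rw [hθA, map_eval_smul_one, Matrix.smul_mulVec, Matrix.one_mulVec]
  -- the away reading of `A(π • 1) y`: `A((1 − ε)π • 1) y`
  have hawayπ : ∀ π : 𝓞 F, A ((1 - ε) • (1 : Matrix (Fin 2) (Fin 2) (FiniteAdeleRing (𝓞 F) F))) *ᵥ
      (A ((algebraMap F (FiniteAdeleRing (𝓞 F) F) ((π : 𝓞 F) : F)) • (1 : Matrix (Fin 2) (Fin 2) (FiniteAdeleRing (𝓞 F) F))) *ᵥ y) =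
        A (((1 - ε) * algebraMap F (FiniteAdeleRing (𝓞 F) F) ((π : 𝓞 F) : F)) • (1 : Matrix (Fin 2) (Fin 2) (FiniteAdeleRing (𝓞 F) F))) *ᵥ y := by
    intro π
    rw [Matrix.mulVec_mulVec, ← map_mul, smul_one_mul_eq_mul_smul_one, Matrix.mul_smul, Matrix.mul_one, smul_smul, mul_comm]
  -- a uniformizer in `𝓞_F`
  obtain ⟨π₀, hπ₀⟩ := u₀.intValuation_exists_uniformizer
  have hπ₀mem : π₀ ∈ u₀.asIdeal := by
    rw [← pow_one u₀.asIdeal, ← IsDedekindDomain.HeightOneSpectrum.intValuation_le_pow_iff_mem, hπ₀, Nat.cast_one]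
  have hπ₀v : Valued.v ((algebraMap F (FiniteAdeleRing (𝓞 F) F) (π₀ : F)) u₀) = WithZero.exp (-1) := by
    rw [IsDedekindDomain.FiniteAdeleRing.algebraMap_apply, IsDedekindDomain.HeightOneSpectrum.valuedAdicCompletion_eq_valuation',
      IsDedekindDomain.HeightOneSpectrum.valuation_of_algebraMap, hπ₀]
  have hπv : ∀ π ∈ u₀.asIdeal, Valued.v ((algebraMap F (FiniteAdeleRing (𝓞 F) F) (π : F)) u₀) ≤ WithZero.exp (-1) := fun π hπ => by
    rw [show (-1 : ℤ) = -((1 : ℕ) : ℤ) by norm_num, valued_algebraMap_apply_le_iff, pow_one]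
    exact hπ
  constructor
  · intro h
    have h' : ∀ π ∈ u₀.asIdeal,
        (∀ i, (A (((1 - ε) * algebraMap F (FiniteAdeleRing (𝓞 F) F) ((π : 𝓞 F) : F)) •
          (1 : Matrix (Fin 2) (Fin 2) (FiniteAdeleRing (𝓞 F) F))) *ᵥ y) i ∈ integralFiniteAdeles ℚ) ∧
        ∀ j, Valued.v ((((algebraMap F (FiniteAdeleRing (𝓞 F) F) ((π : 𝓞 F) : F)) u₀) • θ y) j) ≤ WithZero.exp (-m) := by
      intro π hπ
      have hm := (mem_latticeOfGL_map_iff_readout A u₀ ε θ m hsplit hθint a (ρ π *ᵥ q)).1 (h π hπ)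
      rw [hread, hθπ, hawayπ] at hm
      exact hm
    refine ⟨haway y fun π hπ => (h' π hπ).1, fun j => ?_⟩
    have hj := (h' π₀ hπ₀mem).2 j
    rw [Pi.smul_apply, smul_eq_mul, map_mul, hπ₀v, exp_mul_le_exp_iff] at hj
    rwa [show -m - -1 = -(m - 1) by omega] at hj
  · rintro ⟨hA, hθ⟩ π hπ
    refine (mem_latticeOfGL_map_iff_readout A u₀ ε θ m hsplit hθint a (ρ π *ᵥ q)).2 ⟨?_, fun j => ?_⟩
    · -- away: `A((1−ε)•1) (A(π•1) y) = A(π•1) (A((1−ε)•1) y)` is integral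
      rw [hread, Matrix.mulVec_mulVec, ← map_mul, ← smul_one_mul_eq_mul_smul_one, map_mul, ← Matrix.mulVec_mulVec]
      exact hint π _ hA
    · rw [hread, hθπ, Pi.smul_apply, smul_eq_mul, map_mul]
      calc Valued.v ((algebraMap F (FiniteAdeleRing (𝓞 F) F) (π : F)) u₀) * Valued.v (θ y j)
          ≤ WithZero.exp (-1) * WithZero.exp (-(m - 1)) := mul_le_mul' (hπv π hπ) (hθ j)
        _ = WithZero.exp (-m) := by rw [← WithZero.exp_add]; congr 1; omega

/-! ### §3 (8) DENSITY: every local target is `θ(A(a⁻¹) q)` modulo `B(m,m)` for a rational `q` integral away from `u₀` -/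

/-- `v_{u₀}(n) ≤ exp(−j)` for a natural number `n ∈ 𝔭_{u₀}^j` (read in `𝓞_F`). [folklore] -/
private theorem valued_natCast_le_exp_of_mem_pow (n j : ℕ) (h : ((n : 𝓞 F)) ∈ u₀.asIdeal ^ j) :
    Valued.v ((n : u₀.adicCompletion F)) ≤ WithZero.exp (-(j : ℤ)) := by
  have hv := IsDedekindDomain.HeightOneSpectrum.valuedAdicCompletion_eq_valuation (K := F) u₀ ((n : ℕ) : 𝓞 F)
  change Valued.v (algebraMap (𝓞 F) (u₀.adicCompletion F) (n : 𝓞 F)) = _ at hv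
  rw [map_natCast, IsDedekindDomain.HeightOneSpectrum.valuation_of_algebraMap] at hv
  rw [hv, IsDedekindDomain.HeightOneSpectrum.intValuation_le_pow_iff_mem]
  exact h

/-- `v_{u₀}(n) ≤ 1` for a natural number `n`. [folklore] -/
private theorem valued_natCast_le_one (n : ℕ) : Valued.v ((n : u₀.adicCompletion F)) ≤ 1 := by
  have h := valued_natCast_le_exp_of_mem_pow u₀ n 0 (by rw [pow_zero, Ideal.one_eq_top]; exact Submodule.mem_top)
  rwa [Nat.cast_zero, neg_zero, WithZero.exp_zero] at h

/-- `v_{u₀}(p^k) ≤ exp(−k)` when `p ∈ 𝔭_{u₀}`. [folklore] -/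
private theorem valued_natCast_pow_le_exp {p : ℕ} (hpu : ((p : 𝓞 F)) ∈ u₀.asIdeal) (k : ℕ) :
    Valued.v (((p ^ k : ℕ) : u₀.adicCompletion F)) ≤ WithZero.exp (-(k : ℤ)) := by
  refine valued_natCast_le_exp_of_mem_pow u₀ (p ^ k) k ?_
  rw [Nat.cast_pow]
  exact Ideal.pow_mem_pow hpu k

/-- **(8) DENSITY.**  For every `e ∈ B(m−k, m−k) ⊆ F_{u₀}²` there is a RATIONAL vector `q` whose `a`-frame reading `y = A(a⁻¹) q` is integral away from `u₀` and
has `θ y ≡ e (mod B(m,m))` — strong approximation for the lattice of the rescaled adelic point `p^{−k} · A(a)` (★ `exists_mem_latticeOfGL_mulVec_sub_mem_levelIdeal`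
at level `p^{2k}`), `p` the residue characteristic of `u₀`.  This is the `hdense` input of ★ `LatticeIndexLocalReadout.relIndex_comap_readout_eq` ∕
`le_of_comap_readout_le` for the lattices of (7a)(7b). [cite: Milne2005ShimuraVarieties, §6 Thm. 6.11 p. 74 and p. 75] [cite: Deligne1971TravauxShimura, 4.11–4.12] -/
theorem exists_rat_readout_sub_mem
    (hsplit : ∀ z : N → finAdeleQ, (∀ i, z i ∈ integralFiniteAdeles ℚ) ↔
      (∀ i, (A (ε • (1 : Matrix (Fin 2) (Fin 2) (FiniteAdeleRing (𝓞 F) F))) *ᵥ z) i ∈ integralFiniteAdeles ℚ) ∧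
      (∀ i, (A ((1 - ε) • (1 : Matrix (Fin 2) (Fin 2) (FiniteAdeleRing (𝓞 F) F))) *ᵥ z) i ∈ integralFiniteAdeles ℚ))
    (hθint : ∀ z : N → finAdeleQ,
      (∀ i, (A (ε • (1 : Matrix (Fin 2) (Fin 2) (FiniteAdeleRing (𝓞 F) F))) *ᵥ z) i ∈ integralFiniteAdeles ℚ) ↔
        ∀ j, Valued.v (θ z j) ≤ WithZero.exp (-m))
    (hθA : ∀ (X : Matrix (Fin 2) (Fin 2) (FiniteAdeleRing (𝓞 F) F)) (z : N → finAdeleQ),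
      θ (A X *ᵥ z) = (X.map fun x : FiniteAdeleRing (𝓞 F) F => x u₀) *ᵥ θ z)
    (hθsurj : Function.Surjective θ) (hε : ε * ε = ε) (hε₁ : ε u₀ = 1)
    {p : ℕ} (hp : p ≠ 0) (hpu : ((p : 𝓞 F)) ∈ u₀.asIdeal)
    (a : GL (Fin 2) (FiniteAdeleRing (𝓞 F) F)) (k : ℕ) (e : Fin 2 → u₀.adicCompletion F)
    (he : ∀ j, Valued.v (e j) ≤ WithZero.exp (-(m - k))) :
    ∃ q : N → ℚ,
      (∀ i, (A ((1 - ε) • (1 : Matrix (Fin 2) (Fin 2) (FiniteAdeleRing (𝓞 F) F))) *ᵥ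
          (A ((a⁻¹ : GL (Fin 2) (FiniteAdeleRing (𝓞 F) F)) : Matrix (Fin 2) (Fin 2) (FiniteAdeleRing (𝓞 F) F)) *ᵥ
            (⇑(algebraMap ℚ finAdeleQ) ∘ q))) i ∈ integralFiniteAdeles ℚ) ∧
      ∀ j, Valued.v ((θ (A ((a⁻¹ : GL (Fin 2) (FiniteAdeleRing (𝓞 F) F)) : Matrix (Fin 2) (Fin 2) (FiniteAdeleRing (𝓞 F) F)) *ᵥ
          (⇑(algebraMap ℚ finAdeleQ) ∘ q)) - e) j) ≤ WithZero.exp (-m) := by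
  classical
  -- the two idempotent identities
  have hE11 : A (ε • (1 : Matrix (Fin 2) (Fin 2) (FiniteAdeleRing (𝓞 F) F))) * A (ε • 1) = A (ε • 1) := by
    rw [← map_mul, Matrix.smul_mul, Matrix.one_mul, smul_smul, hε]
  have hE01 : A ((1 - ε) • (1 : Matrix (Fin 2) (Fin 2) (FiniteAdeleRing (𝓞 F) F))) * A (ε • 1) = 0 := by
    rw [← map_mul, Matrix.smul_mul, Matrix.one_mul, smul_smul, sub_mul, one_mul, hε, sub_self, zero_smul, map_zero]
  -- an adelic preimage of `e` supported at `u₀`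
  obtain ⟨y₀, hy₀⟩ := hθsurj e
  have hθy₁ : θ (A (ε • (1 : Matrix (Fin 2) (Fin 2) (FiniteAdeleRing (𝓞 F) F))) *ᵥ y₀) = e := by
    rw [hθA, map_eval_smul_one, hε₁, one_smul, Matrix.one_mulVec, hy₀]
  have hE1y₁ : A (ε • (1 : Matrix (Fin 2) (Fin 2) (FiniteAdeleRing (𝓞 F) F))) *ᵥ (A (ε • 1) *ᵥ y₀) = A (ε • 1) *ᵥ y₀ := by
    rw [Matrix.mulVec_mulVec, hE11]
  have hE0y₁ : A ((1 - ε) • (1 : Matrix (Fin 2) (Fin 2) (FiniteAdeleRing (𝓞 F) F))) *ᵥ (A (ε • 1) *ᵥ y₀) = 0 := by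
    rw [Matrix.mulVec_mulVec, hE01, Matrix.zero_mulVec]
  -- the scale `c = p^k` (a unit of `𝔸_{ℚ,f}`) and the integral target `c • y₁` (as an `ℕ`-multiple)
  have hc0 : p ^ k ≠ 0 := pow_ne_zero _ hp
  have hcu : IsUnit (((p ^ k : ℕ)) : finAdeleQ) := Literature.AlgebraicGeometry.ModuliOfAbelianVarieties.isUnit_natCast_finAdeleQ hc0
  have hcv : Valued.v (((p ^ k : ℕ) : u₀.adicCompletion F)) ≤ WithZero.exp (-(k : ℤ)) := valued_natCast_pow_le_exp u₀ hpu k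
  have hy : ∀ j, ((p ^ k) • (A (ε • (1 : Matrix (Fin 2) (Fin 2) (FiniteAdeleRing (𝓞 F) F))) *ᵥ y₀)) j ∈ integralFiniteAdeles ℚ := by
    have h1 : ∀ j, Valued.v (θ ((p ^ k) • (A (ε • (1 : Matrix (Fin 2) (Fin 2) (FiniteAdeleRing (𝓞 F) F))) *ᵥ y₀)) j) ≤ WithZero.exp (-m) := by
      intro j
      rw [map_nsmul, hθy₁, Pi.smul_apply, nsmul_eq_mul, map_mul]
      calc Valued.v (((p ^ k : ℕ) : u₀.adicCompletion F)) * Valued.v (e j) ≤ WithZero.exp (-(k : ℤ)) * WithZero.exp (-(m - k)) :=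
            mul_le_mul' hcv (he j)
        _ = WithZero.exp (-m) := by rw [← WithZero.exp_add]; congr 1; omega
    have h2 : ∀ i, (A ((1 - ε) • (1 : Matrix (Fin 2) (Fin 2) (FiniteAdeleRing (𝓞 F) F))) *ᵥ
        ((p ^ k) • (A (ε • (1 : Matrix (Fin 2) (Fin 2) (FiniteAdeleRing (𝓞 F) F))) *ᵥ y₀))) i ∈ integralFiniteAdeles ℚ := by
      intro i
      rw [Matrix.mulVec_smul, hE0y₁, smul_zero]
      exact Subring.zero_mem _
    exact (hsplit _).2 ⟨(hθint _).2 h1, h2⟩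
  -- the rescaled adelic point `a″ = A(a) · c⁻¹` and its inverse `c • A(a⁻¹)`
  obtain ⟨a'', ha''⟩ : ∃ a'' : GL N finAdeleQ, ((a''⁻¹ : GL N finAdeleQ) : Matrix N N finAdeleQ) =
      (((p ^ k : ℕ)) : finAdeleQ) • A ((a⁻¹ : GL (Fin 2) (FiniteAdeleRing (𝓞 F) F)) : Matrix (Fin 2) (Fin 2) (FiniteAdeleRing (𝓞 F) F)) := by
    refine ⟨Units.map (A : Matrix (Fin 2) (Fin 2) (FiniteAdeleRing (𝓞 F) F) →* Matrix N N finAdeleQ) a *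
      (Units.map (algebraMap finAdeleQ (Matrix N N finAdeleQ) : finAdeleQ →* Matrix N N finAdeleQ) hcu.unit)⁻¹, ?_⟩
    rw [_root_.mul_inv_rev, inv_inv, Units.val_mul, Units.coe_map, Units.coe_map_inv, IsUnit.unit_spec]
    change algebraMap finAdeleQ (Matrix N N finAdeleQ) (((p ^ k : ℕ)) : finAdeleQ) * _ = _
    rw [Algebra.algebraMap_eq_smul_one, Matrix.smul_mul, Matrix.one_mul]
    rfl
  obtain ⟨q, -, hq⟩ := Literature.NumberTheory.Adeles.exists_mem_latticeOfGL_mulVec_sub_mem_levelIdeal (mul_ne_zero hc0 hc0) a'' hy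
  -- `A(a⁻¹) q = y₁ + c • w` with `w` integral
  have hw : ∀ i, ∃ w ∈ integralFiniteAdeles ℚ,
      (A ((a⁻¹ : GL (Fin 2) (FiniteAdeleRing (𝓞 F) F)) : Matrix (Fin 2) (Fin 2) (FiniteAdeleRing (𝓞 F) F)) *ᵥ
        (⇑(algebraMap ℚ finAdeleQ) ∘ q)) i = (A (ε • (1 : Matrix (Fin 2) (Fin 2) (FiniteAdeleRing (𝓞 F) F))) *ᵥ y₀) i +
          (((p ^ k : ℕ)) : finAdeleQ) * w := by
    intro i
    have h := hq i
    rw [ha'', Matrix.smul_mulVec, Pi.smul_apply, Pi.smul_apply, smul_eq_mul, nsmul_eq_mul, ← mul_sub,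
      Literature.AlgebraicGeometry.ModuliOfAbelianVarieties.mem_levelIdeal_iff] at h
    obtain ⟨w, hw, hNw⟩ := h
    refine ⟨w, (Literature.NumberTheory.Adeles.mem_integralAdeles_iff_mem_integralFiniteAdeles w).1 hw, ?_⟩
    rw [Nat.cast_mul, mul_assoc, hcu.mul_right_inj] at hNw
    rw [← sub_eq_iff_eq_add', hNw]
  choose w hwint hwq using hw
  have hyq : (A ((a⁻¹ : GL (Fin 2) (FiniteAdeleRing (𝓞 F) F)) : Matrix (Fin 2) (Fin 2) (FiniteAdeleRing (𝓞 F) F)) *ᵥ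
      (⇑(algebraMap ℚ finAdeleQ) ∘ q)) = A (ε • (1 : Matrix (Fin 2) (Fin 2) (FiniteAdeleRing (𝓞 F) F))) *ᵥ y₀ + (p ^ k) • w :=
    funext fun i => by rw [Pi.add_apply, Pi.smul_apply, nsmul_eq_mul]; exact hwq i
  refine ⟨q, fun i => ?_, fun j => ?_⟩
  · -- away: `E0 (y₁ + c w) = c • E0 w`, integral
    rw [hyq, Matrix.mulVec_add, hE0y₁, zero_add, Matrix.mulVec_smul, Pi.smul_apply]
    exact nsmul_mem (((hsplit w).1 hwint).2 i) _
  · -- at `u₀`: `θ(y₁ + c w) − e = c • θ w ∈ B(m,m)`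
    have hθw : ∀ j, Valued.v (θ w j) ≤ WithZero.exp (-m) := (hθint w).1 ((hsplit w).1 hwint).1
    rw [hyq, map_add, hθy₁, add_sub_cancel_left, map_nsmul, Pi.smul_apply, nsmul_eq_mul, map_mul]
    calc Valued.v (((p ^ k : ℕ) : u₀.adicCompletion F)) * Valued.v (θ w j) ≤ 1 * WithZero.exp (-m) :=
          mul_le_mul' (valued_natCast_le_one u₀ _) (hθw j)
      _ = WithZero.exp (-m) := one_mul _

/-! ### §4 (7c) The HECKE-NEIGHBOUR lattice `H(g) = 𝔮⁻¹Λ_{a g} ⊓ 𝔭⁻¹Λ_a` read at `u₀` (`𝔮` a prime with a `u₀`-unit, e.g. `𝔭_w`, `w ≠ u₀ = w̄`) -/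

/-- The coordinate map of a scalar multiple: `(c • X).map (· u₀) = c_{u₀} • X.map (· u₀)`. [folklore] -/
private theorem map_eval_smul (c : FiniteAdeleRing (𝓞 F) F) (X : Matrix (Fin 2) (Fin 2) (FiniteAdeleRing (𝓞 F) F)) :
    ((c • X).map fun x : FiniteAdeleRing (𝓞 F) F => x u₀) = (c u₀) • (X.map fun x : FiniteAdeleRing (𝓞 F) F => x u₀) := by
  ext i j
  rfl

/-- **(7c) THE HECKE-NEIGHBOUR LATTICE READ AT `u₀`.**  For a second prime `𝔮` containing a `u₀`-UNIT `π₁` (e.g. `𝔮 = 𝔭_w` at a split `w ≠ u₀ = c•w`) and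
`g ∈ GL₂(𝔸_F)` whose `𝔮`-twists are lattice-integral away from `u₀` (`hg`: `A((1−ε)•(π•g⁻¹))` preserves away-integrality for `π ∈ 𝔮` — the Hecke
double coset `K t K` at a hyperspecial level, ★ `twist_conj_integral_smul_inv_heckeElementAt`) and whose `u₀`-component moves `B(m,m)` into `B(m−1,m−1)`
(`hgloc`): the lattice `H(g) := {q | 𝔮·q ⊆ Λ_{a g} ∧ 𝔭_{u₀}·q ⊆ Λ_a}` is «away-integral ∧ `g_{u₀}⁻¹ θ(A(a⁻¹) q) ∈ B(m,m)`» — i.e. `ι⁻¹(Away_a ⊓ θ_a⁻¹(g_{u₀}•B(m,m)))`.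
[cite: ShimuraIATAF1971, §3.2] [cite: Milne2005ShimuraVarieties, §6 Thm. 6.11 p. 74 and p. 75] [cite: Deligne1971TravauxShimura, 4.11–4.12] -/
theorem forall_mulVec_mem_latticeOfGL_map_mul_iff_readout
    (hsplit : ∀ z : N → finAdeleQ, (∀ i, z i ∈ integralFiniteAdeles ℚ) ↔
      (∀ i, (A (ε • (1 : Matrix (Fin 2) (Fin 2) (FiniteAdeleRing (𝓞 F) F))) *ᵥ z) i ∈ integralFiniteAdeles ℚ) ∧
      (∀ i, (A ((1 - ε) • (1 : Matrix (Fin 2) (Fin 2) (FiniteAdeleRing (𝓞 F) F))) *ᵥ z) i ∈ integralFiniteAdeles ℚ))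
    (hθint : ∀ z : N → finAdeleQ,
      (∀ i, (A (ε • (1 : Matrix (Fin 2) (Fin 2) (FiniteAdeleRing (𝓞 F) F))) *ᵥ z) i ∈ integralFiniteAdeles ℚ) ↔
        ∀ j, Valued.v (θ z j) ≤ WithZero.exp (-m))
    (hθA : ∀ (X : Matrix (Fin 2) (Fin 2) (FiniteAdeleRing (𝓞 F) F)) (z : N → finAdeleQ),
      θ (A X *ᵥ z) = (X.map fun x : FiniteAdeleRing (𝓞 F) F => x u₀) *ᵥ θ z)
    (haway : ∀ z : N → finAdeleQ,
      (∀ π ∈ u₀.asIdeal, ∀ i, (A (((1 - ε) * algebraMap F (FiniteAdeleRing (𝓞 F) F) ((π : 𝓞 F) : F)) •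
        (1 : Matrix (Fin 2) (Fin 2) (FiniteAdeleRing (𝓞 F) F))) *ᵥ z) i ∈ integralFiniteAdeles ℚ) →
      ∀ i, (A ((1 - ε) • (1 : Matrix (Fin 2) (Fin 2) (FiniteAdeleRing (𝓞 F) F))) *ᵥ z) i ∈ integralFiniteAdeles ℚ)
    (hint : ∀ (b : 𝓞 F) (z : N → finAdeleQ), (∀ i, z i ∈ integralFiniteAdeles ℚ) →
      ∀ i, (A ((algebraMap F (FiniteAdeleRing (𝓞 F) F) ((b : 𝓞 F) : F)) • (1 : Matrix (Fin 2) (Fin 2) (FiniteAdeleRing (𝓞 F) F))) *ᵥ z) i ∈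
        integralFiniteAdeles ℚ)
    (ρ : 𝓞 F →+* Matrix N N ℚ)
    (hρ : ∀ b : 𝓞 F, (ρ b).map (algebraMap ℚ finAdeleQ) =
      A ((algebraMap F (FiniteAdeleRing (𝓞 F) F) ((b : 𝓞 F) : F)) • (1 : Matrix (Fin 2) (Fin 2) (FiniteAdeleRing (𝓞 F) F))))
    (𝔮 : Ideal (𝓞 F)) (π₁ : 𝓞 F) (hπ₁ : π₁ ∈ 𝔮) (hπ₁v : Valued.v ((algebraMap F (FiniteAdeleRing (𝓞 F) F) (π₁ : F)) u₀) = 1)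
    (a g : GL (Fin 2) (FiniteAdeleRing (𝓞 F) F))
    (hg : ∀ π ∈ 𝔮, ∀ y : N → finAdeleQ,
      (∀ i, (A ((1 - ε) • (1 : Matrix (Fin 2) (Fin 2) (FiniteAdeleRing (𝓞 F) F))) *ᵥ y) i ∈ integralFiniteAdeles ℚ) →
      ∀ i, (A ((1 - ε) • ((algebraMap F (FiniteAdeleRing (𝓞 F) F) ((π : 𝓞 F) : F)) •
        ((g⁻¹ : GL (Fin 2) (FiniteAdeleRing (𝓞 F) F)) : Matrix (Fin 2) (Fin 2) (FiniteAdeleRing (𝓞 F) F)))) *ᵥ y) i ∈ integralFiniteAdeles ℚ)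
    (hgloc : ∀ ℓ : Fin 2 → u₀.adicCompletion F, (∀ j, Valued.v (ℓ j) ≤ WithZero.exp (-m)) →
      ∀ j, Valued.v ((((g : GL (Fin 2) (FiniteAdeleRing (𝓞 F) F)) : Matrix (Fin 2) (Fin 2) (FiniteAdeleRing (𝓞 F) F)).map
        (fun x : FiniteAdeleRing (𝓞 F) F => x u₀) *ᵥ ℓ) j) ≤ WithZero.exp (-(m - 1)))
    (q : N → ℚ) :
    ((∀ π ∈ 𝔮, ρ π *ᵥ q ∈
        latticeOfGL (Units.map (A : Matrix (Fin 2) (Fin 2) (FiniteAdeleRing (𝓞 F) F) →* Matrix N N finAdeleQ) (a * g))) ∧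
      ∀ π ∈ u₀.asIdeal, ρ π *ᵥ q ∈
        latticeOfGL (Units.map (A : Matrix (Fin 2) (Fin 2) (FiniteAdeleRing (𝓞 F) F) →* Matrix N N finAdeleQ) a)) ↔
      (∀ i, (A ((1 - ε) • (1 : Matrix (Fin 2) (Fin 2) (FiniteAdeleRing (𝓞 F) F))) *ᵥ
          (A ((a⁻¹ : GL (Fin 2) (FiniteAdeleRing (𝓞 F) F)) : Matrix (Fin 2) (Fin 2) (FiniteAdeleRing (𝓞 F) F)) *ᵥ
            (⇑(algebraMap ℚ finAdeleQ) ∘ q))) i ∈ integralFiniteAdeles ℚ) ∧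
      ∀ j, Valued.v ((((g⁻¹ : GL (Fin 2) (FiniteAdeleRing (𝓞 F) F)) : Matrix (Fin 2) (Fin 2) (FiniteAdeleRing (𝓞 F) F)).map
          (fun x : FiniteAdeleRing (𝓞 F) F => x u₀) *ᵥ
        θ (A ((a⁻¹ : GL (Fin 2) (FiniteAdeleRing (𝓞 F) F)) : Matrix (Fin 2) (Fin 2) (FiniteAdeleRing (𝓞 F) F)) *ᵥ
          (⇑(algebraMap ℚ finAdeleQ) ∘ q))) j) ≤ WithZero.exp (-m) := by
  set y : N → finAdeleQ := A ((a⁻¹ : GL (Fin 2) (FiniteAdeleRing (𝓞 F) F)) : Matrix (Fin 2) (Fin 2) (FiniteAdeleRing (𝓞 F) F)) *ᵥ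
    (⇑(algebraMap ℚ finAdeleQ) ∘ q) with hy
  set gi : Matrix (Fin 2) (Fin 2) (FiniteAdeleRing (𝓞 F) F) :=
    ((g⁻¹ : GL (Fin 2) (FiniteAdeleRing (𝓞 F) F)) : Matrix (Fin 2) (Fin 2) (FiniteAdeleRing (𝓞 F) F)) with hgi
  -- the reading of `ρ π q` in the `(a g)`-frame: `A((a g)⁻¹) (ρ π q)^ = A(π • g⁻¹) y`
  have hread : ∀ π : 𝓞 F,
      A (((a * g)⁻¹ : GL (Fin 2) (FiniteAdeleRing (𝓞 F) F)) : Matrix (Fin 2) (Fin 2) (FiniteAdeleRing (𝓞 F) F)) *ᵥ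
          (⇑(algebraMap ℚ finAdeleQ) ∘ (ρ π *ᵥ q)) =
        A ((algebraMap F (FiniteAdeleRing (𝓞 F) F) ((π : 𝓞 F) : F)) • gi) *ᵥ y := by
    intro π
    have h1 : (⇑(algebraMap ℚ finAdeleQ) ∘ (ρ π *ᵥ q)) = (ρ π).map (algebraMap ℚ finAdeleQ) *ᵥ (⇑(algebraMap ℚ finAdeleQ) ∘ q) := by
      funext i
      exact RingHom.map_mulVec (algebraMap ℚ finAdeleQ) (ρ π) q i
    rw [h1, hρ, Matrix.mulVec_mulVec, ← map_mul, _root_.mul_inv_rev, Units.val_mul, Matrix.mul_assoc,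
      ← smul_one_mul_eq_mul_smul_one, ← Matrix.mul_assoc, Matrix.mul_smul, Matrix.mul_one, map_mul, ← Matrix.mulVec_mulVec]
  -- `θ` and away readings of `A(π • g⁻¹) y`
  have hθπ : ∀ π : 𝓞 F, θ (A ((algebraMap F (FiniteAdeleRing (𝓞 F) F) ((π : 𝓞 F) : F)) • gi) *ᵥ y) =
      ((algebraMap F (FiniteAdeleRing (𝓞 F) F) ((π : 𝓞 F) : F)) u₀) • ((gi.map fun x : FiniteAdeleRing (𝓞 F) F => x u₀) *ᵥ θ y) := by
    intro π
    rw [hθA, map_eval_smul, Matrix.smul_mulVec]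
  have hawayπ : ∀ π : 𝓞 F, A ((1 - ε) • (1 : Matrix (Fin 2) (Fin 2) (FiniteAdeleRing (𝓞 F) F))) *ᵥ
      (A ((algebraMap F (FiniteAdeleRing (𝓞 F) F) ((π : 𝓞 F) : F)) • gi) *ᵥ y) =
        A ((1 - ε) • ((algebraMap F (FiniteAdeleRing (𝓞 F) F) ((π : 𝓞 F) : F)) • gi)) *ᵥ y := by
    intro π
    rw [Matrix.mulVec_mulVec, ← map_mul, Matrix.smul_mul, Matrix.one_mul]
  -- valuation of elements of `𝓞_F` at `u₀` is `≤ 1`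
  have hπv : ∀ π : 𝓞 F, Valued.v ((algebraMap F (FiniteAdeleRing (𝓞 F) F) (π : F)) u₀) ≤ 1 := fun π => by
    rw [show (1 : WithZero (Multiplicative ℤ)) = WithZero.exp (-((0 : ℕ) : ℤ)) by rw [Nat.cast_zero, neg_zero, WithZero.exp_zero],
      valued_algebraMap_apply_le_iff, pow_zero, Ideal.one_eq_top]
    exact Submodule.mem_top
  -- the second conjunct is (7b)
  rw [forall_mulVec_mem_latticeOfGL_map_iff_readout A u₀ ε θ m hsplit hθint hθA haway hint ρ hρ a q]
  constructor
  · rintro ⟨h𝔮, hA, -⟩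
    refine ⟨hA, fun j => ?_⟩
    -- from `π₁ ∈ 𝔮`, a `u₀`-unit: the `θ`-clause of (7a) at `a g`
    have hm := ((mem_latticeOfGL_map_iff_readout A u₀ ε θ m hsplit hθint (a * g) (ρ π₁ *ᵥ q)).1 (h𝔮 π₁ hπ₁)).2 j
    rw [hread, hθπ, Pi.smul_apply, smul_eq_mul, map_mul, hπ₁v, one_mul] at hm
    exact hm
  · rintro ⟨hA, hθ⟩
    have hθ' : ∀ j, Valued.v (θ y j) ≤ WithZero.exp (-(m - 1)) := by
      have hgg : ((g : GL (Fin 2) (FiniteAdeleRing (𝓞 F) F)) : Matrix (Fin 2) (Fin 2) (FiniteAdeleRing (𝓞 F) F)).map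
          (fun x : FiniteAdeleRing (𝓞 F) F => x u₀) *ᵥ ((gi.map fun x : FiniteAdeleRing (𝓞 F) F => x u₀) *ᵥ θ y) = θ y := by
        -- multiplicativity of `X ↦ X_{u₀}` is read off `hθA` (no matrix algebra over `𝔸_F` needed)
        rw [← hθA, ← hθA, Matrix.mulVec_mulVec, ← map_mul, hgi, ← Units.val_mul, mul_inv_cancel, Units.val_one, map_one,
          Matrix.one_mulVec]
      intro j
      rw [← hgg]
      exact hgloc _ hθ j
    refine ⟨fun π hπ => ?_, hA, hθ'⟩
    refine (mem_latticeOfGL_map_iff_readout A u₀ ε θ m hsplit hθint (a * g) (ρ π *ᵥ q)).2 ⟨fun i => ?_, fun j => ?_⟩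
    · rw [hread, hawayπ]
      exact hg π hπ y hA i
    · rw [hread, hθπ, Pi.smul_apply, smul_eq_mul, map_mul]
      calc Valued.v ((algebraMap F (FiniteAdeleRing (𝓞 F) F) (π : F)) u₀) *
            Valued.v (((gi.map fun x : FiniteAdeleRing (𝓞 F) F => x u₀) *ᵥ θ y) j)
          ≤ 1 * WithZero.exp (-m) := mul_le_mul' (hπv π) (hθ j)
        _ = WithZero.exp (-m) := one_mul _

end Literature.NumberTheory.Adeles.Readout

end
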